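/-
Copyright (c) 2026 the pub-hodgecm-mathlib formalisation cell (harness21).  Prover seat hodgecm-mathlib-LH4-p02 (g8): LH4-plan (g6) WORD #33 «NORM-ONE TORUS CAYLEY
DRESS, any residue characteristic» (the torus form of mechanism M5 «Cayley ∕ Möbius level shift by `ord_w 2`» of census F0P3a-p06 (g17) `DUNR-H2-CENSUS` §3); 2026-09-02.
-/
import Literature.NumberTheory.LocalFields.CayleyLevelShift   -- ★ LH4-p01 (g6): the scalar Cayley level shift (C1)–(C5), any value group; brings Mathlib `Valued`
import HarnessLib

/-!
# The NORM-ONE TORUS through the Cayley map: `x ↦ (1 + x)∕(1 − x)` maps the SKEW ball `{σ x = −x, |x| ≤ r}` (`r < 1`) bijectively onto the norm-one level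
# `{σ y · y = 1, |y − 1| ≤ |2|·r}` — at residue characteristic `2` the torus filtration is the skew filtration shifted by `ord 2` (Serre, *Local Fields* IV §2, V §3; O'Meara §63)

Topic `NumberTheory/LocalFields`; namespace `Literature.NumberTheory.LocalFields`.  THEOREMS ONLY (no definition, no instance, no notation, no named fact, no `sorry`;
axioms ⊆ {propext, Classical.choice, Quot.sound}).  Cell `pub/hodgecm-mathlib` (D-0151), crux H413 = `stmt-HodgeConjecture-24833`; half A line LH4, DYADIC pay-down leaf
`Cruxes/H413/Lines/F0_P3c_DyadicPaydown.lean`, organs (D-UNR)∕(D-RAM) (PRINT by ruling D74′).  HONEST READER LABEL: BANKED base layer, consumers none live; HC_CM is proved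
only modulo the 7 printed citations (2 remaining named inputs: hLiu418 = stmt-HodgeConjecture-24832, h413 = stmt-HodgeConjecture-24833) until rung 0 closes; generic valued-field
algebra, count-neutral, pays no letter by itself.

SETTING.  `K` a field with a valuation `Valued.v : K → Γ₀` (ANY value group; §3 dresses the discrete case `Γ₀ = ℤᵐ⁰`), `σ : K →+* K` a bare ring endomorphism (the
non-trivial automorphism of a quadratic `K ∕ K₀` in every application; isometry `|σ x| = |x|` is assumed ONLY where used, involutivity never).  SKEW letter `σ x = −x`;
NORM-ONE (torus) letter `σ y · y = 1` (the tree's binder shape, ★ `RamifiedPlaceNormOneTorus`, ★ `SplitTorusOrderCayleyShift.map_cayley_mul_cayley`); Cayley map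
`c(x) = (1 + x)∕(1 − x)`, inverse `y ↦ (y − 1)∕(y + 1)` (★ `CayleyLevelShift` §0, spelled out as lambdas).  The SCALAR level shift is ★ `CayleyLevelShift`:
(C1) `|c(x) − 1| = |2|·|x|` (`|x| < 1`), (C2) `|(y − 1)∕(y + 1)| = |y − 1|∕|2|` (`|y − 1| < |2|`), (C3) `c : {|x| ≤ r} ≃ {|y − 1| ≤ |2|·r}` (`r < 1`, `2 ≠ 0`), (C4) distances.
THIS FILE cuts (C3) down to the `σ`-eigen-sets: skew on the left, norm-one on the right.

* §1 SKEW ↔ NORM-ONE.  (T0) `valued_eq_one_of_map_mul_self_eq_one`: a norm-one element is a unit (`|σ y| = |y|`).  (T1) `map_cayley_mul_cayley_of_valued_lt_one`: for a skew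
  `x` in the open unit ball, `c(x)` is NORM-ONE (the 2-free identity ★ `Automorphic.map_cayley_mul_cayley` `σ c(Z)·c(Z) = 1` for `σ Z = −Z`, `1 ± Z ≠ 0` — here `1 ± x ≠ 0`
  because `|1 ± x| = 1`, ★ `valued_one_sub_and_one_add_eq_one_of_lt_one`; re-derived as a local step, not restated); its level is (C1).  (T2)
  `map_invCayley_eq_neg_of_valued_sub_one_lt_two`: for a norm-one `y` with `|y − 1| < |2|` the Cayley parameter `(y − 1)∕(y + 1)` is SKEW (★
  `Automorphic.map_cayleyParam_eq_neg` needs only `σ y·y = 1` and `y + 1 ≠ 0`; here `|y + 1| = |2| ≠ 0`); its level is (C2).  (T3) `mapsTo_cayley_skew_level`,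
  `mapsTo_invCayley_normOne_level`, `invOn_cayley_skew_level`, **`bijOn_cayley_skew_level`**: for `r < 1`, `2 ≠ 0`, `c` is a BIJECTION
  `{σ x = −x, |x| ≤ r} → {σ y·y = 1, |y − 1| ≤ |2|·r}`; `image_cayley_skew_level`, `bijOn_invCayley_normOne_level`, and the BALL form **`bijOn_cayley_skew_ball`**
  `{σ x = −x, |x| < 1} → {σ y·y = 1, |y − 1| < |2|}`.
* §2 HONESTY (what the integral skew ball does NOT reach).  A norm-one `y` has `|y − 1| ≤ 1` (`valued_sub_one_le_one_of_map_mul_self_eq_one`), and the trichotomy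
  `|y − 1| < |2|` ∕ `= |2|` ∕ `∈ (|2|, 1]` is read by the Cayley parameter: `valued_invCayley_lt_one_iff` (`|(y−1)∕(y+1)| < 1 ↔ |y − 1| < |2|`, for `y + 1 ≠ 0`),
  `valued_add_one_eq_valued_sub_one_of_two_lt` and **`valued_invCayley_eq_one_of_two_lt`** (`|2| < |y − 1|` ⇒ `|y + 1| = |y − 1|` and the parameter is a UNIT),
  `one_le_valued_invCayley_of_two_le` (`|2| ≤ |y − 1|`, `y ≠ −1` ⇒ parameter of absolute value `≥ 1`).  So at `|2| = exp(−e) < 1` the torus levels `T⁽ʲ⁾ ∖ T⁽ʲ⁺¹⁾`,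
  `0 ≤ j ≤ e`, (e.g. `y = u∕σu` with `u = 1 + ϖ^j t` under an involutive isometric `σ`, or `y = −1`) are NOT Cayley images of integral non-unit skew elements — they have
  UNIT (or non-integral, or no) skew parameters, which ★ `Automorphic.map_cayleyParam_eq_neg` still makes skew; only `T⁽ᵉ⁺ʲ⁾`, `j ≥ 1`, is charted by the skew ball
  of level `j`.  At `|2| = 1` the middle and upper branches are empty below level `0` and (C3) preserves levels (§3, `bijOn_cayley_skew_level_of_two`).
* §3 THE `ℤᵐ⁰` DRESS.  **`bijOn_cayley_skew_level_exp`**: `|2| = exp(−e)`, `1 ≤ j` ⇒ `c : {σ x = −x, |x| ≤ exp(−j)} ≃ {σ y·y = 1, |y − 1| ≤ exp(−(j + e))}` — «skew level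
  `j` ↔ torus level `j + e`»; `bijOn_invCayley_normOne_level_exp`; the tame shape `bijOn_cayley_skew_level_of_two` (`|2| = 1`: skew level `r` ↔ torus level `r`, the
  scalar statement behind ★ `SplitTorusCayleyShiftValued` §3 ∕ ★ `UnitaryGroupCayley`, which carry `|2| = 1`).
* (T5) DISTANCES on the torus are (C4) verbatim: `|c(xᵢ) − c(xⱼ)| = |2|·|xᵢ − xⱼ|` (★ `valued_cayley_sub_cayley_of_lt_one`) and `|(yᵢ−1)∕(yᵢ+1) − (yⱼ−1)∕(yⱼ+1)| =
  |yᵢ − yⱼ|∕|2|` (★ `valued_invCayley_sub_invCayley`) — cited, not restated.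
USE (none live; banked for the (D-RAM)∕(D-UNR) consumer re-bases M1∕M5 of the p06 census): at a dyadic CM place `w ∣ v` with `σ = σ_w`, the norm-one torus
`T = U(1)(L⁺_v) = {σ t · t = 1}` (★ `RamifiedPlaceNormOneTorus`, ★ `WildQuadraticNormOneTorus`) is charted near `1` by the skew line `{σ x = −x} = δ·L⁺_v` through `c`, every
torus level `T⁽ᵉ⁺ʲ⁾` being the image of the skew level `j` — the «level shift by `ord_w 2`» that re-bases the tame (`|2| = 1`) torus orbital-integral rows.

## References
* [Serre1979] J.-P. Serre, *Local Fields*, GTM 67 (1979): Ch. IV §2 (the filtration `U⁽ⁿ⁾` and `i_G`), Ch. V §3 (norm-one elements and their filtration in a cyclic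
  totally ramified extension), Ch. XIV §4 (dyadic units).
* [Omeara1963] O. T. O'Meara, *Introduction to Quadratic Forms*, Grundlehren 117 (1963), §63 (dyadic local fields: the unit filtration and `ord 2`).
* [Weil1964] A. Weil, *Sur certains groupes d'opérateurs unitaires*, Acta Math. 111 (1964), §29 (the Cayley transform of a unitary∕norm-one element).
-/

set_option autoImplicit false

noncomputable section

open scoped Valued
open WithZero

namespace Literature.NumberTheory.LocalFields

/-! ## §1 SKEW `σ x = −x` ↔ NORM-ONE `σ y · y = 1` through the Cayley map -/

section Valued

variable {K : Type*} [Field K] {Γ₀ : Type*} [LinearOrderedCommGroupWithZero Γ₀] [Valued K Γ₀] {σ : K →+* K}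

/-- (T0) A NORM-ONE element is a UNIT: `σ y · y = 1`, `|σ y| = |y|` ⇒ `|y| = 1` (`|y|² = 1` in a linearly ordered value group). [cite: Serre1979, Ch. V §3] -/
theorem valued_eq_one_of_map_mul_self_eq_one (hσv : ∀ x, Valued.v (σ x) = Valued.v x) {y : K} (hy : σ y * y = 1) :
    Valued.v y = 1 := by
  have h : Valued.v y * Valued.v y = 1 := by
    have h' := congrArg Valued.v hy
    rwa [map_mul, hσv, map_one] at h'
  rcases lt_trichotomy (Valued.v y) 1 with hlt | heq | hgt
  · refine absurd h (ne_of_lt ?_)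
    calc Valued.v y * Valued.v y ≤ Valued.v y * 1 := mul_le_mul_right hlt.le _
      _ < 1 := by rw [mul_one]; exact hlt
  · exact heq
  · refine absurd h (ne_of_gt ?_)
    calc (1 : Γ₀) < Valued.v y := hgt
      _ = Valued.v y * 1 := (mul_one _).symm
      _ ≤ Valued.v y * Valued.v y := mul_le_mul_right hgt.le _

/-- A norm-one element sits at level `≥ 0`: `σ y · y = 1`, `|σ y| = |y|` ⇒ `|y − 1| ≤ 1`. [cite: Serre1979, Ch. V §3] -/
theorem valued_sub_one_le_one_of_map_mul_self_eq_one (hσv : ∀ x, Valued.v (σ x) = Valued.v x) {y : K} (hy : σ y * y = 1) :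
    Valued.v (y - 1) ≤ 1 := by
  calc Valued.v (y - 1) ≤ max (Valued.v y) (Valued.v (1 : K)) := Valuation.map_sub _ _ _
    _ = 1 := by rw [valued_eq_one_of_map_mul_self_eq_one hσv hy, map_one, max_self]

/-- **(T1) SKEW ⇒ NORM-ONE**: for `σ x = −x` with `|x| < 1`, `y = (1 + x)∕(1 − x)` satisfies `σ y · y = 1` (`σ y = (1 − x)∕(1 + x)`; `1 ± x ≠ 0` since `|1 ± x| = 1`).  The 2-free
identity is ★ `Automorphic.map_cayley_mul_cayley` (hypotheses `1 ± Z ≠ 0`), re-derived here under the valued hypothesis; the LEVEL of `y` is (C1) ★ `valued_cayley_sub_one`: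
`|y − 1| = |2|·|x|`. [cite: Weil1964, §29] [cite: Serre1979, Ch. V §3] -/
theorem map_cayley_mul_cayley_of_valued_lt_one {x : K} (hσx : σ x = -x) (hx : Valued.v x < 1) :
    σ ((1 + x) / (1 - x)) * ((1 + x) / (1 - x)) = 1 := by
  obtain ⟨hm1, hp1⟩ := valued_one_sub_and_one_add_eq_one_of_lt_one hx
  have hm : (1 - x : K) ≠ 0 := fun h0 => by rw [h0, map_zero] at hm1; exact zero_ne_one hm1
  have hp : (1 + x : K) ≠ 0 := fun h0 => by rw [h0, map_zero] at hp1; exact zero_ne_one hp1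
  rw [map_div₀, map_add, map_sub, map_one, hσx, sub_neg_eq_add, ← sub_eq_add_neg]
  field_simp

/-- **(T2) NORM-ONE ⇒ SKEW PARAMETER**: for `σ y · y = 1` with `|y − 1| < |2|`, the Cayley parameter `x = (y − 1)∕(y + 1)` satisfies `σ x = −x` (`σ y = y⁻¹`,
`(y⁻¹ − 1)∕(y⁻¹ + 1) = −(y − 1)∕(y + 1)`; `y + 1 ≠ 0` because `|y + 1| = |2| ≠ 0`, ★ `add_one_ne_zero_of_valued_sub_one_lt_two`).  The identity is ★
`Automorphic.map_cayleyParam_eq_neg` (hypothesis `y + 1 ≠ 0`), re-derived here under the valued hypothesis; the LEVEL of `x` is (C2) ★ `valued_invCayley`: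
`|x| = |y − 1|∕|2| < 1`. [cite: Weil1964, §29] [cite: Serre1979, Ch. V §3] -/
theorem map_invCayley_eq_neg_of_valued_sub_one_lt_two {y : K} (hy : σ y * y = 1) (hy1 : Valued.v (y - 1) < Valued.v (2 : K)) :
    σ ((y - 1) / (y + 1)) = -((y - 1) / (y + 1)) := by
  have hg1 : y + 1 ≠ 0 := add_one_ne_zero_of_valued_sub_one_lt_two hy1
  have hy0 : y ≠ 0 := fun h0 => by rw [h0, mul_zero] at hy; exact zero_ne_one hy
  have hσ : σ y = y⁻¹ := eq_inv_of_mul_eq_one_left hy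
  have hσ1 : σ y + 1 ≠ 0 := by
    rw [hσ]; intro h0
    apply hg1
    have : y⁻¹ = -1 := eq_neg_of_add_eq_zero_left h0
    have hy' : y = -1 := by rw [← inv_inv y, this, inv_neg, inv_one]
    rw [hy']; ring
  have h1y : 1 + y ≠ 0 := by rwa [add_comm]
  rw [map_div₀, map_sub, map_add, map_one, hσ]
  field_simp
  ring

/-- (T3) `c` maps the skew level `{σ x = −x, |x| ≤ r}` (`r < 1`) INTO the norm-one level `{σ y·y = 1, |y − 1| ≤ |2|·r}`. [cite: Serre1979, Ch. V §3] -/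
theorem mapsTo_cayley_skew_level {r : Γ₀} (hr : r < 1) :
    Set.MapsTo (fun x : K => (1 + x) / (1 - x)) {x | σ x = -x ∧ Valued.v x ≤ r} {y | σ y * y = 1 ∧ Valued.v (y - 1) ≤ Valued.v (2 : K) * r} :=
  fun _ hx => ⟨map_cayley_mul_cayley_of_valued_lt_one hx.1 (hx.2.trans_lt hr), valued_cayley_sub_one_le_mul hr hx.2⟩

/-- (T3) `y ↦ (y − 1)∕(y + 1)` maps the norm-one level `{σ y·y = 1, |y − 1| ≤ |2|·r}` INTO the skew level `{σ x = −x, |x| ≤ r}` (`r < 1`, `2 ≠ 0`). [cite: Serre1979, Ch. V §3] -/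
theorem mapsTo_invCayley_normOne_level {r : Γ₀} (hr : r < 1) (h2 : (2 : K) ≠ 0) :
    Set.MapsTo (fun y : K => (y - 1) / (y + 1)) {y | σ y * y = 1 ∧ Valued.v (y - 1) ≤ Valued.v (2 : K) * r} {x | σ x = -x ∧ Valued.v x ≤ r} :=
  fun _ hy => ⟨map_invCayley_eq_neg_of_valued_sub_one_lt_two hy.1 (hy.2.trans_lt (valued_two_mul_lt_two hr h2)),
    valued_invCayley_le_of_le_mul hr h2 hy.2⟩

/-- (T3) The two maps are inverse to each other on the `σ`-cut level sets (★ `invOn_cayley_level`, restricted). [cite: Omeara1963, §63] -/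
theorem invOn_cayley_skew_level {r : Γ₀} (hr : r < 1) (h2 : (2 : K) ≠ 0) :
    Set.InvOn (fun y : K => (y - 1) / (y + 1)) (fun x : K => (1 + x) / (1 - x))
      {x | σ x = -x ∧ Valued.v x ≤ r} {y | σ y * y = 1 ∧ Valued.v (y - 1) ≤ Valued.v (2 : K) * r} :=
  (invOn_cayley_level hr h2).mono (fun _ hx => hx.2) (fun _ hy => hy.2)

/-- **(T3) THE NORM-ONE TORUS CAYLEY LEVEL SHIFT**: for `r < 1` and `2 ≠ 0`, `x ↦ (1 + x)∕(1 − x)` is a BIJECTION from the skew level `{σ x = −x, |x| ≤ r}` onto the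
norm-one level `{σ y · y = 1, |y − 1| ≤ |2|·r}`, inverse `y ↦ (y − 1)∕(y + 1)`.  At residue characteristic `2` the torus filtration is the skew-line filtration shifted
by `ord 2`; at `|2| = 1` levels are preserved (§3). [cite: Serre1979, Ch. V §3] [cite: Omeara1963, §63] [cite: Weil1964, §29] -/
theorem bijOn_cayley_skew_level {r : Γ₀} (hr : r < 1) (h2 : (2 : K) ≠ 0) :
    Set.BijOn (fun x : K => (1 + x) / (1 - x)) {x | σ x = -x ∧ Valued.v x ≤ r} {y | σ y * y = 1 ∧ Valued.v (y - 1) ≤ Valued.v (2 : K) * r} :=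
  (invOn_cayley_skew_level hr h2).bijOn (mapsTo_cayley_skew_level hr) (mapsTo_invCayley_normOne_level hr h2)

/-- (T3) The image form: `c '' {σ x = −x, |x| ≤ r} = {σ y·y = 1, |y − 1| ≤ |2|·r}` (`r < 1`, `2 ≠ 0`). [cite: Serre1979, Ch. V §3] -/
theorem image_cayley_skew_level {r : Γ₀} (hr : r < 1) (h2 : (2 : K) ≠ 0) :
    (fun x : K => (1 + x) / (1 - x)) '' {x | σ x = -x ∧ Valued.v x ≤ r} = {y | σ y * y = 1 ∧ Valued.v (y - 1) ≤ Valued.v (2 : K) * r} :=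
  (bijOn_cayley_skew_level hr h2).image_eq

/-- (T3) The inverse bijection: `y ↦ (y − 1)∕(y + 1)` from the norm-one level `{σ y·y = 1, |y − 1| ≤ |2|·r}` onto the skew level `{σ x = −x, |x| ≤ r}` (`r < 1`, `2 ≠ 0`).
[cite: Serre1979, Ch. V §3] [cite: Omeara1963, §63] -/
theorem bijOn_invCayley_normOne_level {r : Γ₀} (hr : r < 1) (h2 : (2 : K) ≠ 0) :
    Set.BijOn (fun y : K => (y - 1) / (y + 1)) {y | σ y * y = 1 ∧ Valued.v (y - 1) ≤ Valued.v (2 : K) * r} {x | σ x = -x ∧ Valued.v x ≤ r} :=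
  (invOn_cayley_skew_level hr h2).symm.bijOn (mapsTo_invCayley_normOne_level hr h2) (mapsTo_cayley_skew_level hr)

/-- **(T3, BALL form)**: `x ↦ (1 + x)∕(1 − x)` is a bijection from the open skew ball `{σ x = −x, |x| < 1}` onto `{σ y · y = 1, |y − 1| < |2|}` (`2 ≠ 0`) — the part of the
norm-one torus charted by integral non-unit skew parameters (§2 says what is left out). [cite: Serre1979, Ch. V §3] [cite: Weil1964, §29] -/
theorem bijOn_cayley_skew_ball (h2 : (2 : K) ≠ 0) :
    Set.BijOn (fun x : K => (1 + x) / (1 - x)) {x | σ x = -x ∧ Valued.v x < 1} {y | σ y * y = 1 ∧ Valued.v (y - 1) < Valued.v (2 : K)} := by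
  refine Set.InvOn.bijOn (f' := fun y : K => (y - 1) / (y + 1)) ⟨fun x hx => ?_, fun y hy => ?_⟩ (fun x hx => ⟨?_, ?_⟩) (fun y hy => ⟨?_, ?_⟩)
  · exact invCayley_cayley_of_valued_lt_one hx.2 h2
  · exact cayley_invCayley_of_valued_sub_one_lt_two hy.2
  · exact map_cayley_mul_cayley_of_valued_lt_one hx.1 hx.2
  · exact valued_cayley_sub_one_lt_two hx.2 h2
  · exact map_invCayley_eq_neg_of_valued_sub_one_lt_two hy.1 hy.2
  · exact valued_invCayley_lt_one hy.2

/-! ## §2 HONESTY: the norm-one levels NOT reached from the integral skew ball -/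

/-- `|2| < |y − 1| ⇒ |y + 1| = |y − 1|` (`y + 1 = (y − 1) + 2`, strict ultrametric maximum). [cite: Omeara1963, §63] -/
theorem valued_add_one_eq_valued_sub_one_of_two_lt {y : K} (h : Valued.v (2 : K) < Valued.v (y - 1)) :
    Valued.v (y + 1) = Valued.v (y - 1) := by
  rw [show y + 1 = (y - 1) + 2 by ring, Valuation.map_add_eq_of_lt_left _ h]

/-- **(T4) `|2| < |y − 1| ⇒ |(y − 1)∕(y + 1)| = 1`**: a norm-one (or any) element of level strictly between `|2|` and `1` has a UNIT Cayley parameter — it is not the Cayley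
image of an integral non-unit skew element (whose images have `|y − 1| = |2|·|x| < |2|`, (C1)); the parameter is still skew by ★ `Automorphic.map_cayleyParam_eq_neg`.  Example
(involutive isometric `σ`, `|2| = exp(−e)`): `y = u∕σu`, `u = 1 + ϖ^j t`, `0 ≤ j < e` generic. [cite: Omeara1963, §63] [cite: Serre1979, Ch. V §3] -/
theorem valued_invCayley_eq_one_of_two_lt {y : K} (h : Valued.v (2 : K) < Valued.v (y - 1)) :
    Valued.v ((y - 1) / (y + 1)) = 1 := by
  have hne : Valued.v (y - 1) ≠ 0 := ne_of_gt (lt_of_le_of_lt zero_le h)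
  rw [map_div₀, valued_add_one_eq_valued_sub_one_of_two_lt h, div_self hne]

/-- (T4) `|2| ≤ |y − 1|`, `y + 1 ≠ 0` ⇒ `1 ≤ |(y − 1)∕(y + 1)|` (`|y + 1| ≤ max (|y − 1|, |2|) = |y − 1|`): at level EXACTLY `|2|` (e.g. `y = 1 + 2u`, `u` a unit; `y = −1` has no
parameter) the Cayley parameter is a unit or non-integral. [cite: Omeara1963, §63] -/
theorem one_le_valued_invCayley_of_two_le {y : K} (h : Valued.v (2 : K) ≤ Valued.v (y - 1)) (hy1 : y + 1 ≠ 0) :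
    1 ≤ Valued.v ((y - 1) / (y + 1)) := by
  have hpos : 0 < Valued.v (y + 1) := zero_lt_iff.2 ((Valuation.ne_zero_iff _).2 hy1)
  have hle : Valued.v (y + 1) ≤ Valued.v (y - 1) := by
    calc Valued.v (y + 1) ≤ max (Valued.v (2 : K)) (Valued.v (y - 1)) := valued_add_one_le_max y
      _ = Valued.v (y - 1) := max_eq_right h
  rw [map_div₀, one_le_div₀ hpos]
  exact hle

/-- **(T4) THE HONEST `iff`**: for `y + 1 ≠ 0`, the Cayley parameter is an integral NON-UNIT iff the level of `y` is below `|2|`: `|(y − 1)∕(y + 1)| < 1 ↔ |y − 1| < |2|`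
((⟸) is (C2) ★ `valued_invCayley_lt_one`; (⟹) is the contrapositive of `one_le_valued_invCayley_of_two_le`). [cite: Omeara1963, §63] [cite: Serre1979, Ch. IV §2] -/
theorem valued_invCayley_lt_one_iff {y : K} (hy1 : y + 1 ≠ 0) :
    Valued.v ((y - 1) / (y + 1)) < 1 ↔ Valued.v (y - 1) < Valued.v (2 : K) :=
  ⟨fun h => lt_of_not_ge fun h' => not_lt_of_ge (one_le_valued_invCayley_of_two_le h' hy1) h, valued_invCayley_lt_one⟩

/-- (T4) For a norm-one `y` under an isometric `σ` the three branches `|y − 1| < |2|`, `|y − 1| = |2|`, `|2| < |y − 1| ≤ 1` exhaust the torus (`|y − 1| ≤ 1`); only the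
first is charted by the open integral skew ball (`bijOn_cayley_skew_ball`). [cite: Serre1979, Ch. V §3] -/
theorem valued_sub_one_lt_two_or_eq_or_lt_of_map_mul_self_eq_one (hσv : ∀ x, Valued.v (σ x) = Valued.v x) {y : K} (hy : σ y * y = 1) :
    Valued.v (y - 1) < Valued.v (2 : K) ∨ Valued.v (y - 1) = Valued.v (2 : K) ∨
      (Valued.v (2 : K) < Valued.v (y - 1) ∧ Valued.v (y - 1) ≤ 1) := by
  rcases lt_trichotomy (Valued.v (y - 1)) (Valued.v (2 : K)) with h | h | h
  · exact Or.inl h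
  · exact Or.inr (Or.inl h)
  · exact Or.inr (Or.inr ⟨h, valued_sub_one_le_one_of_map_mul_self_eq_one hσv hy⟩)

end Valued

/-! ## §3 The `ℤᵐ⁰` dress: skew level `j` ↔ torus level `j + e` (`|2| = exp(−e)`), and the tame shape `|2| = 1` -/

section Discrete

variable {K : Type*} [Field K] [Valued K ℤᵐ⁰] {σ : K →+* K}

/-- **(T3, `ℤᵐ⁰`) «skew level `j` ↔ torus level `j + ord 2`»**: for `|2| = exp(−e)` and `1 ≤ j`, `x ↦ (1 + x)∕(1 − x)` is a bijection from `{σ x = −x, |x| ≤ exp(−j)}`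
onto `{σ y · y = 1, |y − 1| ≤ exp(−(j + e))}`, inverse `y ↦ (y − 1)∕(y + 1)` — the norm-one filtration `T⁽ᵉ⁺ʲ⁾` is the skew filtration of level `j`.
[cite: Serre1979, Ch. V §3] [cite: Omeara1963, §63] -/
theorem bijOn_cayley_skew_level_exp {e : ℕ} (he : Valued.v (2 : K) = exp (-(e : ℤ))) {j : ℕ} (hj : 1 ≤ j) :
    Set.BijOn (fun x : K => (1 + x) / (1 - x)) {x | σ x = -x ∧ Valued.v x ≤ exp (-(j : ℤ))}
      {y | σ y * y = 1 ∧ Valued.v (y - 1) ≤ exp (-((j : ℤ) + e))} := by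
  have h := bijOn_cayley_skew_level (K := K) (σ := σ) (exp_neg_lt_one_of_one_le hj) (two_ne_zero_of_valued_two_eq_exp he)
  rwa [he, exp_neg_mul_exp_neg] at h

/-- The inverse bijection in `ℤᵐ⁰`: `y ↦ (y − 1)∕(y + 1)` from `{σ y·y = 1, |y − 1| ≤ exp(−(j + e))}` onto `{σ x = −x, |x| ≤ exp(−j)}` (`|2| = exp(−e)`, `1 ≤ j`).
[cite: Serre1979, Ch. V §3] -/
theorem bijOn_invCayley_normOne_level_exp {e : ℕ} (he : Valued.v (2 : K) = exp (-(e : ℤ))) {j : ℕ} (hj : 1 ≤ j) :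
    Set.BijOn (fun y : K => (y - 1) / (y + 1)) {y | σ y * y = 1 ∧ Valued.v (y - 1) ≤ exp (-((j : ℤ) + e))}
      {x | σ x = -x ∧ Valued.v x ≤ exp (-(j : ℤ))} := by
  have h := bijOn_invCayley_normOne_level (K := K) (σ := σ) (exp_neg_lt_one_of_one_le hj) (two_ne_zero_of_valued_two_eq_exp he)
  rwa [he, exp_neg_mul_exp_neg] at h

/-- (T3, TAME SHAPE) For `|2| = 1` and `r < 1`, `c` is a bijection from `{σ x = −x, |x| ≤ r}` onto `{σ y·y = 1, |y − 1| ≤ r}` — levels PRESERVED (the scalar statement behind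
★ `SplitTorusCayleyShiftValued` §3 and ★ `UnitaryGroupCayley`, which carry `|2| = 1`). [cite: Serre1979, Ch. V §3] -/
theorem bijOn_cayley_skew_level_of_two (h2 : Valued.v (2 : K) = 1) {r : ℤᵐ⁰} (hr : r < 1) :
    Set.BijOn (fun x : K => (1 + x) / (1 - x)) {x | σ x = -x ∧ Valued.v x ≤ r} {y | σ y * y = 1 ∧ Valued.v (y - 1) ≤ r} := by
  have h20 : (2 : K) ≠ 0 := fun h0 => by rw [h0, map_zero] at h2; exact zero_ne_one h2
  have h := bijOn_cayley_skew_level (K := K) (σ := σ) hr h20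
  rwa [h2, one_mul] at h

end Discrete

end Literature.NumberTheory.LocalFields
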